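import Summits.ResolutionOfSingularities.ResolutionOfSingularities.Theorems.FrobeniusLadderFRationalResolutionGaloisResidueEmbedding
import Mathlib.RingTheory.Unramified.Field
import Mathlib.RingTheory.Jacobson.Ring
import HarnessLib

/-!
# Crux `FrobeniusLadder.FRationalResolution` (stmt-ResolutionOfSingularities-15317), line `redirect`,
# stub `stub_diagonalizableQuotientResolution` — the field glue of the Galois route FROM THE CHART DATA: an unramified
# chart of finite type at a twisted point yields `(K', 𝔔', ι)`

Companion of `…GaloisResidueEmbedding.exists_galois_residue_embedding` (finite Galois `K'/K`, maximal `𝔔' ⊆ B ⊗_K K'`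
over `𝔭`, residue embedding `ι : C/𝔔 → (B ⊗_K K')/𝔔'` compatible with `B`), with its field-theoretic hypotheses
DERIVED from the data the isolated-point lane actually holds: `B` of finite type over the field `K` (so `κ(𝔭)/K` is
finite, Zariski's lemma `finite_of_finite_type_of_isJacobsonRing`), `C` of finite type and formally unramified over `B`
— e.g. the étale quotient chart — and `𝔔` maximal over `𝔭` (so `κ(𝔔)/κ(𝔭)` is of finite type and formally unramified,
hence finite separable: `Algebra.FormallyUnramified.finite_of_free`, `Algebra.FormallyUnramified.isSeparable`), for the
canonical residue algebra `B/𝔭 → C/𝔔` (`Ideal.Quotient.algebraQuotientOfLEComap`).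

* **`exists_galois_residue_embedding_of_formallyUnramified`** — `[Algebra.FiniteType K B] [Algebra.FiniteType B C]
  [Algebra.FormallyUnramified B C]`, `𝔔.comap = 𝔭` ⇒ `∃ K'` finite Galois, `𝔔'` maximal over `𝔭`, `ι` compatible.

Honest label: plumbing toward ONE leaf stub (no stub, crux or summit closed): together with `…GaloisUpstairsPiece`
(p834009), `…GaloisFibreUnramified` (p834143) and `…GaloisBaseChangeRegular` (p833582) the Galois route for the isolated
twisted case of `stub_diagonalizableQuotientResolution` now takes from the chart only the decomposition-stability `hD` of
the produced piece. No definitions, no named facts, no sorry. [cite: StacksProject, Tag 00FZ; Tag 02G8; Tag 0EXM]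
-/

noncomputable section

-- single-problem summit: the doubled namespace component is forced
set_option linter.dupNamespace false

open scoped TensorProduct

namespace Summit.ResolutionOfSingularities.ResolutionOfSingularities.Theorems.FRationalResolution.GaloisResidueEmbeddingEtale

open GaloisResidueEmbedding

/-- **Field glue of the Galois route, from an unramified chart of finite type.** `K` a field, `B` a `K`-algebra of
finite type, `C` a `B`-algebra of finite type, formally unramified over `B` (e.g. étale); `𝔔 ⊆ C` maximal over the
maximal `𝔭 ⊆ B`. Then `κ(𝔭)/K` is finite (Zariski's lemma) and `κ(𝔔)/κ(𝔭)` is finite separable (unramified), so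
`exists_galois_residue_embedding` applies to the canonical residue algebra `B/𝔭 → C/𝔔`: there are a finite Galois
`K'/K`, a maximal `𝔔' ⊆ B ⊗_K K'` over `𝔭` and `ι : C/𝔔 → (B ⊗_K K')/𝔔'` compatible with `B`.
[cite: StacksProject, Tag 00FZ; Tag 02G8; Tag 0EXM] -/
theorem exists_galois_residue_embedding_of_formallyUnramified (K : Type) [Field K] {B C : Type} [CommRing B]
    [CommRing C] [Algebra K B] [Algebra.FiniteType K B] [Algebra B C] [Algebra.FiniteType B C]
    [Algebra.FormallyUnramified B C]
    (𝔭 : Ideal B) [𝔭.IsMaximal] (𝔔 : Ideal C) [𝔔.IsMaximal] (h𝔔𝔭 : 𝔔.comap (algebraMap B C) = 𝔭) :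
    ∃ (K' : Type) (_ : Field K') (_ : Algebra K K'), FiniteDimensional K K' ∧ IsGalois K K' ∧
      ∃ (𝔔' : Ideal (B ⊗[K] K')), 𝔔'.IsMaximal ∧ 𝔔'.comap (algebraMap B (B ⊗[K] K')) = 𝔭 ∧
        ∃ ι : C ⧸ 𝔔 →+* (B ⊗[K] K') ⧸ 𝔔',
          ∀ b : B, ι (Ideal.Quotient.mk 𝔔 (algebraMap B C b)) =
            Ideal.Quotient.mk 𝔔' (algebraMap B (B ⊗[K] K') b) := by
  letI : Field (B ⧸ 𝔭) := Ideal.Quotient.field 𝔭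
  letI : Field (C ⧸ 𝔔) := Ideal.Quotient.field 𝔔
  -- the canonical residue algebra `B/𝔭 → C/𝔔`
  letI : Algebra (B ⧸ 𝔭) (C ⧸ 𝔔) := Ideal.Quotient.algebraQuotientOfLEComap h𝔔𝔭.ge
  have halg : ∀ b : B, algebraMap (B ⧸ 𝔭) (C ⧸ 𝔔) (Ideal.Quotient.mk 𝔭 b) =
      Ideal.Quotient.mk 𝔔 (algebraMap B C b) := fun _ => rfl
  haveI : IsScalarTower B (B ⧸ 𝔭) (C ⧸ 𝔔) := IsScalarTower.of_algebraMap_eq fun b => (halg b).symm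
  -- `κ(𝔭)/K` finite (Zariski's lemma)
  haveI : Algebra.FiniteType K (B ⧸ 𝔭) :=
    (inferInstance : Algebra.FiniteType K B).of_surjective (Ideal.Quotient.mkₐ K 𝔭) Ideal.Quotient.mk_surjective
  haveI : Module.Finite K (B ⧸ 𝔭) := finite_of_finite_type_of_isJacobsonRing K (B ⧸ 𝔭)
  haveI : Algebra.IsAlgebraic K (B ⧸ 𝔭) := Algebra.IsAlgebraic.of_finite K (B ⧸ 𝔭)
  -- `κ(𝔔)/κ(𝔭)` of finite type and formally unramified, hence finite separable
  haveI : Algebra.FiniteType B (C ⧸ 𝔔) :=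
    (inferInstance : Algebra.FiniteType B C).of_surjective (Ideal.Quotient.mkₐ B 𝔔) Ideal.Quotient.mk_surjective
  haveI : Algebra.FiniteType (B ⧸ 𝔭) (C ⧸ 𝔔) := Algebra.FiniteType.of_restrictScalars_finiteType B (B ⧸ 𝔭) (C ⧸ 𝔔)
  haveI : Algebra.FormallyUnramified B (C ⧸ 𝔔) := Algebra.FormallyUnramified.comp B C (C ⧸ 𝔔)
  haveI : Algebra.FormallyUnramified (B ⧸ 𝔭) (C ⧸ 𝔔) :=
    Algebra.FormallyUnramified.of_restrictScalars (R := B) (A := B ⧸ 𝔭) (B := C ⧸ 𝔔)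
  haveI : Module.Finite (B ⧸ 𝔭) (C ⧸ 𝔔) := Algebra.FormallyUnramified.finite_of_free (R := B ⧸ 𝔭) (S := C ⧸ 𝔔)
  haveI : Algebra.IsSeparable (B ⧸ 𝔭) (C ⧸ 𝔔) := Algebra.FormallyUnramified.isSeparable (B ⧸ 𝔭) (C ⧸ 𝔔)
  exact exists_galois_residue_embedding K 𝔭 𝔔 halg

end Summit.ResolutionOfSingularities.ResolutionOfSingularities.Theorems.FRationalResolution.GaloisResidueEmbeddingEtale

end
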